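import Summits.Ventures.PercRepro.RankLevelSetLevelSixHeavyCellSq27DI2V
import Summits.Ventures.PercRepro.RankLevelSetCoreSixColoopFreeUnion
import Summits.Ventures.PercRepro.RankLevelSetLevelSixCapGlue25
import Summits.Ventures.PercRepro.TriangleCapEightI
import Summits.Ventures.PercRepro.S1TrianglePlusSharp
import Summits.Ventures.PercRepro.S1SeriesLever14
import Summits.Ventures.PercRepro.RankLevelSetCircuitUnionRank
import Summits.Ventures.PercRepro.RankLevelSetDepCountHeavyB
import Summits.Ventures.PercRepro.RankLevelSetFourCircuitNullityFourSharp
import Summits.Ventures.PercRepro.RankLevelSetFiveCircuitNullityFourSharp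
import Summits.Ventures.PercRepro.RankLevelSetLevelSixArithHeavySq23TN1718A
import Summits.Ventures.PercRepro.RankLevelSetLevelSixArithHeavySq23TN19_23TZ8A

/-!
# PercRepro — THE 23 ROW, CORANKS 17 … 19: THE HONEST EVERY-CORE CELLS (THE H-TERM FACTOR) (p8 g11, S3)

`proofs/SUBCLAIM-S3-p8.md` §3y. `(phiK p 6)·#U ≤ #Y` on every `e`-free core of rank `p ≥ 23`, corank `17`, on the cell `sq27di2v` with the `H`-term factor `p + 17 − 19` (`ν₁ = 12`, `j = 1`, `j′ = 1`, `|UG| ≤ 28`, `|UH| ≤ 19`, `Kn/Kd = 4638/1000`; `D = C(p + 6, 6)`; caps `s₃ ≤ 62`, `s₄ ≤ 887`, `s₅ ≤ 11964`, `s₆ ≤ 74613`, `s₇ ≤ 245157` at `n₀ = 40`; parts RankLevelSetLevelSixArithHeavySq23TN17A). Axioms: standard.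

`proofs/SUBCLAIM-S3-p8.md` §3y. `(phiK p 6)·#U ≤ #Y` on every `e`-free core of rank `p ≥ 23`, corank `18`, on the cell `sq27di2v` with the `H`-term factor `p + 18 − 19` (`ν₁ = 13`, `j = 1`, `j′ = 1`, `|UG| ≤ 29`, `|UH| ≤ 19`, `Kn/Kd = 3744/1000`; `D = C(p + 6, 6)`; caps `s₃ ≤ 71`, `s₄ ≤ 1073`, `s₅ ≤ 15287`, `s₆ ≤ 100947`, `s₇ ≤ 346104` at `n₀ = 41`; parts RankLevelSetLevelSixArithHeavySq23TN18A). Axioms: standard.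

`proofs/SUBCLAIM-S3-p8.md` §3y. `(phiK p 6)·#U ≤ #Y` on every `e`-free core of rank `p ≥ 23`, corank `19`, on the cell `sq27di2v` with the `H`-term factor `p + 19 − 19` (`ν₁ = 14`, `j = 1`, `j′ = 1`, `|UG| ≤ 30`, `|UH| ≤ 19`, `Kn/Kd = 3099/1000`; `D = C(p + 6, 6)`; caps `s₃ ≤ 81`, `s₄ ≤ 1287`, `s₅ ≤ 19309`, `s₆ ≤ 134596`, `s₇ ≤ 480700` at `n₀ = 42`; parts RankLevelSetLevelSixArithHeavySq23TN19A). Axioms: standard.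
-/

open scoped Matroid

namespace PercRepro

namespace ThmN

open Set

variable {α : Type}

-- ===== RankLevelSetLevelSixT23Every17 =====


/-- **THE HONEST EVERY-CORE CELL `(p ≥ 23, 17)` of the `23` row at corank `17`** (level 0, `phiK p 6`, `D = C(p + 6, 6)`). -/
theorem c025_core_six_t23_every17 (M : Matroid α) [M.Finite] (p : ℕ) (hp : 23 ≤ p)
    (hR : M.eRank = (p : ℕ∞)) (hn : M.E.ncard = p + 17)
    (hfree : ∀ e ∈ M.E, ∃ A ⊆ M.E \ {e}, e ∉ M.closure A ∧ e ∉ M.closure ((M.E \ {e}) \ A)) :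
    RLS M p 6 := by
  classical
  have hd : M.E.encard = M.eRank + (17 : ℕ) := by
    rw [hR, ← M.ground_finite.cast_ncard_eq, hn]
    push_cast
    ring
  have hL : ∀ e ∈ M.E, ¬ M.IsLoop e := not_isLoop_of_free M hfree
  have hs : ∀ e ∈ M.E, ∀ f ∈ M.E, e ≠ f → M.eRk {e, f} = 2 := by
    intro e he f hf hef
    have h2 : (2 : ℕ∞) ≤ M.eRk {e, f} :=
      two_le_eRk_of_two_le_ncard_of_free M hfree (pair_subset he hf) (by rw [ncard_pair hef])
    have h3 : M.eRk {e, f} ≤ 2 := by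
      have := M.eRk_le_encard {e, f}
      rwa [encard_pair hef] at this
    exact le_antisymm h3 h2
  have hc : ∀ X ⊆ M.E, M.eRk X ≤ ((6 - 2 : ℕ) : ℕ∞) → (X.ncard : ℕ∞) ≤ M.eRk X + cnull 4 :=
    fun X hX hr => nullity_cap_core M hfree 4 (le_refl 4) X hX (by simpa using hr)
  have hc6 : cnull 4 + 1 ≤ 12 := by simp [cnull]
  have hcj : ∀ X ⊆ M.E, M.eRk X ≤ ((6 - 1 - 1 : ℕ) : ℕ∞) → (X.ncard : ℕ∞) ≤ M.eRk X + cnull (4) :=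
    fun X hX hr => nullity_cap_core M hfree 4 (by omega) X hX
      (by rwa [show (6 - 1 - 1 : ℕ) = 4 by omega] at hr)
  have hcj' : ∀ X ⊆ M.E, M.eRk X ≤ ((6 - 1 - 1 - 1 : ℕ) : ℕ∞) → (X.ncard : ℕ∞) ≤ M.eRk X + cnull (3) :=
    fun X hX hr => nullity_cap_core M hfree 3 (by omega) X hX
      (by rwa [show (6 - 1 - 1 - 1 : ℕ) = 3 by omega] at hr)
  have hUG : (Matroid.UG M 6 12).ncard ≤ 28 := by
    have := Matroid.ncard_UG_le (M := M) (q := 6) (ν₁ := 12) (j := 1) (by norm_num) hd hc hc6 hcj (by norm_num [cnull])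
    simpa using this
  have hcap : ∀ X ⊆ M.E, ∀ k : ℕ, M.eRk X ≤ k → X.ncard ≤ k + 17 := by
    intro X hX k hr
    have h1 := Matroid.encard_le_eRk_add_of_encard_eq hX hd
    have h2 : X.encard ≤ (k : ℕ∞) + ((17 : ℕ) : ℕ∞) := h1.trans (add_le_add_left hr _)
    have hfin : X.Finite := M.ground_finite.subset hX
    rw [← hfin.cast_ncard_eq] at h2; exact_mod_cast h2
  have hflat' : ∀ X ⊆ M.E, M.eRk X ≤ ((6 - 1 : ℕ) : ℕ∞) → X.ncard ≤ 19 :=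
    fun X hX hr => ncard_le_nineteen_of_eRk_le_five_of_free M hfree hX (by simpa using hr)
  have hUH : (Matroid.UH M 6 12).ncard ≤ 19 :=
    Matroid.ncard_UH_le_of_unique (M := M) (q := 6) (ν₁ := 12) hd hc (by norm_num [cnull]) hflat'
  have hΦ : phiK p 6 ≤ (2 : ℚ) ^ (p + 6) / (((p + 6).choose 6 : ℕ) : ℚ) := phiK_le_two_pow_div_six p
  rw [RLS_iff]
  exact c025_core_six_heavy_cell_sq27di2v M p 17 12 28 19 0 4638 1000 23 11964 887 62 74613 245157
      ((p + 6).choose 6) (Nat.choose_pos (by omega)) (phiK p 6) hΦ (by norm_num) (by omega)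
      (by norm_num) hUG hUH (by omega) (Or.inl (by norm_num)) (by norm_num) (by norm_num) (by norm_num)
      ((TriangleCap.core_ncard_triangles_le_cq3 M hfree hd).trans (by decide))
      ((ncard_fourCircuits_le_avgChain14 17 M hfree hd).trans (by decide))
      ((S1.ncard_fiveCircuits_le_avgChain5c 17 M hfree hd).trans (by decide))
      ((Matroid.ncard_circuits_le_choose_of_encard M hd 5).trans (by decide))
      ((Matroid.ncard_circuits_le_choose_of_encard M hd 6).trans (by decide))
      (Or.inl (tail_six_heavy_sq23TN17_17 p hp)) hR hn hfree (level_six_poly_heavy_sq23TN17_17 p hp)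

-- ===== RankLevelSetLevelSixT23Every18 =====


/-- **THE HONEST EVERY-CORE CELL `(p ≥ 23, 18)` of the `23` row at corank `18`** (level 0, `phiK p 6`, `D = C(p + 6, 6)`). -/
theorem c025_core_six_t23_every18 (M : Matroid α) [M.Finite] (p : ℕ) (hp : 23 ≤ p)
    (hR : M.eRank = (p : ℕ∞)) (hn : M.E.ncard = p + 18)
    (hfree : ∀ e ∈ M.E, ∃ A ⊆ M.E \ {e}, e ∉ M.closure A ∧ e ∉ M.closure ((M.E \ {e}) \ A)) :
    RLS M p 6 := by
  classical
  have hd : M.E.encard = M.eRank + (18 : ℕ) := by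
    rw [hR, ← M.ground_finite.cast_ncard_eq, hn]
    push_cast
    ring
  have hL : ∀ e ∈ M.E, ¬ M.IsLoop e := not_isLoop_of_free M hfree
  have hs : ∀ e ∈ M.E, ∀ f ∈ M.E, e ≠ f → M.eRk {e, f} = 2 := by
    intro e he f hf hef
    have h2 : (2 : ℕ∞) ≤ M.eRk {e, f} :=
      two_le_eRk_of_two_le_ncard_of_free M hfree (pair_subset he hf) (by rw [ncard_pair hef])
    have h3 : M.eRk {e, f} ≤ 2 := by
      have := M.eRk_le_encard {e, f}
      rwa [encard_pair hef] at this
    exact le_antisymm h3 h2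
  have hc : ∀ X ⊆ M.E, M.eRk X ≤ ((6 - 2 : ℕ) : ℕ∞) → (X.ncard : ℕ∞) ≤ M.eRk X + cnull 4 :=
    fun X hX hr => nullity_cap_core M hfree 4 (le_refl 4) X hX (by simpa using hr)
  have hc6 : cnull 4 + 1 ≤ 13 := by simp [cnull]
  have hcj : ∀ X ⊆ M.E, M.eRk X ≤ ((6 - 1 - 1 : ℕ) : ℕ∞) → (X.ncard : ℕ∞) ≤ M.eRk X + cnull (4) :=
    fun X hX hr => nullity_cap_core M hfree 4 (by omega) X hX
      (by rwa [show (6 - 1 - 1 : ℕ) = 4 by omega] at hr)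
  have hcj' : ∀ X ⊆ M.E, M.eRk X ≤ ((6 - 1 - 1 - 1 : ℕ) : ℕ∞) → (X.ncard : ℕ∞) ≤ M.eRk X + cnull (3) :=
    fun X hX hr => nullity_cap_core M hfree 3 (by omega) X hX
      (by rwa [show (6 - 1 - 1 - 1 : ℕ) = 3 by omega] at hr)
  have hUG : (Matroid.UG M 6 13).ncard ≤ 29 := by
    have := Matroid.ncard_UG_le (M := M) (q := 6) (ν₁ := 13) (j := 1) (by norm_num) hd hc hc6 hcj (by norm_num [cnull])
    simpa using this
  have hcap : ∀ X ⊆ M.E, ∀ k : ℕ, M.eRk X ≤ k → X.ncard ≤ k + 18 := by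
    intro X hX k hr
    have h1 := Matroid.encard_le_eRk_add_of_encard_eq hX hd
    have h2 : X.encard ≤ (k : ℕ∞) + ((18 : ℕ) : ℕ∞) := h1.trans (add_le_add_left hr _)
    have hfin : X.Finite := M.ground_finite.subset hX
    rw [← hfin.cast_ncard_eq] at h2; exact_mod_cast h2
  have hflat' : ∀ X ⊆ M.E, M.eRk X ≤ ((6 - 1 : ℕ) : ℕ∞) → X.ncard ≤ 19 :=
    fun X hX hr => ncard_le_nineteen_of_eRk_le_five_of_free M hfree hX (by simpa using hr)
  have hUH : (Matroid.UH M 6 13).ncard ≤ 19 :=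
    Matroid.ncard_UH_le_of_unique (M := M) (q := 6) (ν₁ := 13) hd hc (by norm_num [cnull]) hflat'
  have hΦ : phiK p 6 ≤ (2 : ℚ) ^ (p + 6) / (((p + 6).choose 6 : ℕ) : ℚ) := phiK_le_two_pow_div_six p
  rw [RLS_iff]
  exact c025_core_six_heavy_cell_sq27di2v M p 18 13 29 19 0 3744 1000 24 15287 1073 71 100947 346104
      ((p + 6).choose 6) (Nat.choose_pos (by omega)) (phiK p 6) hΦ (by norm_num) (by omega)
      (by norm_num) hUG hUH (by omega) (Or.inl (by norm_num)) (by norm_num) (by norm_num) (by norm_num)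
      ((TriangleCap.core_ncard_triangles_le_cq3 M hfree hd).trans (by decide))
      ((ncard_fourCircuits_le_avgChain14 18 M hfree hd).trans (by decide))
      ((S1.ncard_fiveCircuits_le_avgChain5c 18 M hfree hd).trans (by decide))
      ((Matroid.ncard_circuits_le_choose_of_encard M hd 5).trans (by decide))
      ((Matroid.ncard_circuits_le_choose_of_encard M hd 6).trans (by decide))
      (Or.inl (tail_six_heavy_sq23TN18_18 p hp)) hR hn hfree (level_six_poly_heavy_sq23TN18_18 p hp)

-- ===== RankLevelSetLevelSixT23Every19 =====


/-- **THE HONEST EVERY-CORE CELL `(p ≥ 23, 19)` of the `23` row at corank `19`** (level 0, `phiK p 6`, `D = C(p + 6, 6)`). -/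
theorem c025_core_six_t23_every19 (M : Matroid α) [M.Finite] (p : ℕ) (hp : 23 ≤ p)
    (hR : M.eRank = (p : ℕ∞)) (hn : M.E.ncard = p + 19)
    (hfree : ∀ e ∈ M.E, ∃ A ⊆ M.E \ {e}, e ∉ M.closure A ∧ e ∉ M.closure ((M.E \ {e}) \ A)) :
    RLS M p 6 := by
  classical
  have hd : M.E.encard = M.eRank + (19 : ℕ) := by
    rw [hR, ← M.ground_finite.cast_ncard_eq, hn]
    push_cast
    ring
  have hL : ∀ e ∈ M.E, ¬ M.IsLoop e := not_isLoop_of_free M hfree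
  have hs : ∀ e ∈ M.E, ∀ f ∈ M.E, e ≠ f → M.eRk {e, f} = 2 := by
    intro e he f hf hef
    have h2 : (2 : ℕ∞) ≤ M.eRk {e, f} :=
      two_le_eRk_of_two_le_ncard_of_free M hfree (pair_subset he hf) (by rw [ncard_pair hef])
    have h3 : M.eRk {e, f} ≤ 2 := by
      have := M.eRk_le_encard {e, f}
      rwa [encard_pair hef] at this
    exact le_antisymm h3 h2
  have hc : ∀ X ⊆ M.E, M.eRk X ≤ ((6 - 2 : ℕ) : ℕ∞) → (X.ncard : ℕ∞) ≤ M.eRk X + cnull 4 :=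
    fun X hX hr => nullity_cap_core M hfree 4 (le_refl 4) X hX (by simpa using hr)
  have hc6 : cnull 4 + 1 ≤ 14 := by simp [cnull]
  have hcj : ∀ X ⊆ M.E, M.eRk X ≤ ((6 - 1 - 1 : ℕ) : ℕ∞) → (X.ncard : ℕ∞) ≤ M.eRk X + cnull (4) :=
    fun X hX hr => nullity_cap_core M hfree 4 (by omega) X hX
      (by rwa [show (6 - 1 - 1 : ℕ) = 4 by omega] at hr)
  have hcj' : ∀ X ⊆ M.E, M.eRk X ≤ ((6 - 1 - 1 - 1 : ℕ) : ℕ∞) → (X.ncard : ℕ∞) ≤ M.eRk X + cnull (3) :=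
    fun X hX hr => nullity_cap_core M hfree 3 (by omega) X hX
      (by rwa [show (6 - 1 - 1 - 1 : ℕ) = 3 by omega] at hr)
  have hUG : (Matroid.UG M 6 14).ncard ≤ 30 := by
    have := Matroid.ncard_UG_le (M := M) (q := 6) (ν₁ := 14) (j := 1) (by norm_num) hd hc hc6 hcj (by norm_num [cnull])
    simpa using this
  have hcap : ∀ X ⊆ M.E, ∀ k : ℕ, M.eRk X ≤ k → X.ncard ≤ k + 19 := by
    intro X hX k hr
    have h1 := Matroid.encard_le_eRk_add_of_encard_eq hX hd
    have h2 : X.encard ≤ (k : ℕ∞) + ((19 : ℕ) : ℕ∞) := h1.trans (add_le_add_left hr _)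
    have hfin : X.Finite := M.ground_finite.subset hX
    rw [← hfin.cast_ncard_eq] at h2; exact_mod_cast h2
  have hflat' : ∀ X ⊆ M.E, M.eRk X ≤ ((6 - 1 : ℕ) : ℕ∞) → X.ncard ≤ 19 :=
    fun X hX hr => ncard_le_nineteen_of_eRk_le_five_of_free M hfree hX (by simpa using hr)
  have hUH : (Matroid.UH M 6 14).ncard ≤ 19 :=
    Matroid.ncard_UH_le_of_unique (M := M) (q := 6) (ν₁ := 14) hd hc (by norm_num [cnull]) hflat'
  have hΦ : phiK p 6 ≤ (2 : ℚ) ^ (p + 6) / (((p + 6).choose 6 : ℕ) : ℚ) := phiK_le_two_pow_div_six p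
  rw [RLS_iff]
  exact c025_core_six_heavy_cell_sq27di2v M p 19 14 30 19 0 3099 1000 25 19309 1287 81 134596 480700
      ((p + 6).choose 6) (Nat.choose_pos (by omega)) (phiK p 6) hΦ (by norm_num) (by omega)
      (by norm_num) hUG hUH (by omega) (Or.inl (by norm_num)) (by norm_num) (by norm_num) (by norm_num)
      ((TriangleCap.core_ncard_triangles_le_cq3 M hfree hd).trans (by decide))
      ((ncard_fourCircuits_le_avgChain14 19 M hfree hd).trans (by decide))
      ((S1.ncard_fiveCircuits_le_avgChain5c 19 M hfree hd).trans (by decide))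
      ((Matroid.ncard_circuits_le_choose_of_encard M hd 5).trans (by decide))
      ((Matroid.ncard_circuits_le_choose_of_encard M hd 6).trans (by decide))
      (Or.inl (tail_six_heavy_sq23TN19_19 p hp)) hR hn hfree (level_six_poly_heavy_sq23TN19_19 p hp)

end ThmN

end PercRepro
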